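import Mathlib
import Literature.NumberTheory.LFunctions.WeilBochnerRepresentationRH
import Literature.NumberTheory.LFunctions.ZetaZeroOrdinateSums
import Literature.NumberTheory.LFunctions.WeilMellinVerticalCalculus
import Literature.NumberTheory.LFunctions.WeilChirpDecay
import HarnessLib

/-!
# The zero energy of a Weil test under RH is controlled by its Gallagher cells (local zero counts)

Helper file (`--supports stmt-RiemannHypothesis-0098`, lead-track anchor: Weil-positivity window ladder, format-C far bound),
pure proofs over BUILT Literature imports.  Seat rh-explicit-weil-1 gen15 (memo
`run/shared/lean/pub/rh-explicit/rh-explicit-weil-1/FORMAT-K3.md` §16.4): first input of the LOWER half of the second-order law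
(`Q_a(v) ≥ −K‖v‖² − ZERO(v)` needs an UPPER bound for the zero energy `ZERO(v)` of a smoothed residual).

Under RH the Weil form of a test `g` IS its zero energy `Re Q(g) = ∫ ‖ĝ(½+it)‖² dν(t)`, `ν = Σ_ρ m(ρ)δ_{Im ρ}`
(`WeilBochner.weilQuadratic_eq_integral_of_riemannHypothesis`).  The zeros have bounded local counts
`Σ_{|Im ρ − c| ≤ ½} m(ρ) ≤ C_w log(|c| + 2)` (`ZeroOrdinateSums.exists_sum_le_of_abs_im_sub_le`), and on a unit cell a `C¹` function
is dominated by its cell integrals (Gallagher):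

* `le_cellIntegral_add_of_hasDerivAt` — `F(t) ≤ ∫_{[k−½,k+½]} F + ∫_{[k−½,k+½]} |F'|` for `t` in the cell;
* `norm_sq_weilMellin_le_cellIntegral` — for `F = ‖ĝ(½+i·)‖²` (`F' = 2Re(conj ĝ·ĝ₁)`, `ĝ₁ = (ixg)^`, `WeilMellinVerticalCalculus`):
  `‖ĝ(½+it)‖² ≤ ∫_{cell} (‖ĝ‖² + 2‖ĝ‖‖ĝ₁‖)`;
* ★ `weilQuadratic_re_le_of_cellBound_of_RH` — **`∃ C > 0, ∀ g, RH → (∀ finite K, Σ_{k∈K} ψ_g(k)·log(|k|+2) ≤ Ψ) → Re Q(g) ≤ C·Ψ`**,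
  `ψ_g(k) = ∫_{[k−½,k+½]} (‖ĝ(½+is)‖² + 2‖ĝ(½+is)‖‖ĝ₁(½+is)‖) ds` (the ordinate-majorant summation
  `ZeroOrdinateSums.tsum_mul_le_of_ordinate_majorant`).
The cell sums are then bounded by Plancherel on the critical line (`WeilFarFloorZeroEnergyMoments`).  Standard axioms only.
-/

set_option linter.dupNamespace false
set_option autoImplicit false

noncomputable section

open MeasureTheory Set Filter Complex
open scoped Real Topology

namespace Summit.RiemannHypothesis.RiemannHypothesis.Theorems.WeilFormatC

namespace FloorZeroEnergy

open Literature.NumberTheory.LFunctions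

/-! ## §1 Gallagher's cell inequality -/

/-- **Gallagher's cell inequality.**  If `F` has a continuous derivative `F'` on `ℝ`, then for `t` in the unit cell
`[k − ½, k + ½]`:  `F(t) ≤ ∫_{[k−½,k+½]} F + ∫_{[k−½,k+½]} |F'|`. -/
theorem le_cellIntegral_add_of_hasDerivAt {F F' : ℝ → ℝ} (hF : ∀ t, HasDerivAt F (F' t) t) (hF'c : Continuous F')
    {k : ℤ} {t : ℝ} (ht : t ∈ Icc ((k : ℝ) - 1 / 2) ((k : ℝ) + 1 / 2)) :
    F t ≤ (∫ s in Icc ((k : ℝ) - 1 / 2) ((k : ℝ) + 1 / 2), F s)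
      + ∫ s in Icc ((k : ℝ) - 1 / 2) ((k : ℝ) + 1 / 2), |F' s| := by
  set a : ℝ := (k : ℝ) - 1 / 2 with ha
  set b : ℝ := (k : ℝ) + 1 / 2 with hb
  have hab : a ≤ b := by rw [ha, hb]; linarith
  have hFc : Continuous F := continuous_iff_continuousAt.2 fun x ↦ (hF x).continuousAt
  have hvol : volume.real (Icc a b) = 1 := by rw [Real.volume_real_Icc_of_le hab, hb, ha]; ring
  set A := ∫ s in Icc a b, |F' s| with hA
  have hA0 : 0 ≤ A := setIntegral_nonneg measurableSet_Icc fun s _ ↦ abs_nonneg _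
  have hF'i : IntegrableOn (fun s ↦ |F' s|) (Icc a b) := (hF'c.abs.continuousOn).integrableOn_Icc
  -- `|∫_s^{t'} F'| ≤ A` inside the cell
  have key : ∀ s t' : ℝ, s ≤ t' → s ∈ Icc a b → t' ∈ Icc a b → |∫ x in s..t', F' x| ≤ A := by
    intro s t' hst hs ht'
    calc |∫ x in s..t', F' x| ≤ ∫ x in s..t', |F' x| := intervalIntegral.abs_integral_le_integral_abs hst
      _ = ∫ x in Ioc s t', |F' x| := intervalIntegral.integral_of_le hst
      _ ≤ A := setIntegral_mono_set hF'i (ae_of_all _ fun _ ↦ abs_nonneg _)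
          (ae_of_all _ fun x hx ↦ ⟨hs.1.trans hx.1.le, hx.2.trans ht'.2⟩)
  -- pointwise: `F t ≤ F s + A` for every `s` in the cell (FTC)
  have hpt : ∀ s ∈ Icc a b, F t ≤ F s + A := by
    intro s hs
    rcases le_total s t with hst | hts
    · have hftc : ∫ x in s..t, F' x = F t - F s :=
        intervalIntegral.integral_eq_sub_of_hasDerivAt (fun x _ ↦ hF x) (hF'c.intervalIntegrable _ _)
      have h1 := key s t hst hs ht
      rw [hftc] at h1
      linarith only [(abs_le.1 h1).2]
    · have hftc : ∫ x in t..s, F' x = F s - F t :=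
        intervalIntegral.integral_eq_sub_of_hasDerivAt (fun x _ ↦ hF x) (hF'c.intervalIntegrable _ _)
      have h1 := key t s hts ht hs
      rw [hftc] at h1
      linarith only [(abs_le.1 h1).1]
  -- integrate over the cell (measure one)
  have hFi : IntegrableOn F (Icc a b) := hFc.continuousOn.integrableOn_Icc
  have h1 : ∫ s in Icc a b, F t = F t := by rw [setIntegral_const, hvol, one_smul]
  have hAc : IntegrableOn (fun _ : ℝ ↦ A) (Icc a b) := integrableOn_const (by simp [Real.volume_Icc])
  have hTc : IntegrableOn (fun _ : ℝ ↦ F t) (Icc a b) := integrableOn_const (by simp [Real.volume_Icc])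
  have h2 : ∫ s in Icc a b, (F s + A) = (∫ s in Icc a b, F s) + A := by
    rw [integral_add hFi hAc, setIntegral_const, hvol, one_smul]
  have hmono : ∫ s in Icc a b, F t ≤ ∫ s in Icc a b, (F s + A) :=
    setIntegral_mono_on hTc (hFi.add hAc) measurableSet_Icc hpt
  rw [h1, h2] at hmono
  exact hmono

/-! ## §2 The cells of `‖G‖²` for a differentiable `G : ℝ → ℂ`, and of `‖ĝ(½+it)‖²` -/

/-- **`‖G(t)‖²` is dominated by its cell integrals**: for `G : ℝ → ℂ` with continuous derivative `G₁` and `t ∈ [k − ½, k + ½]`,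
`‖G t‖² ≤ ∫_{[k−½,k+½]} (‖G s‖² + 2‖G s‖·‖G₁ s‖) ds` (`(‖G‖²)' = 2⟪G, G₁⟫_ℝ`, `|⟪G, G₁⟫_ℝ| ≤ ‖G‖‖G₁‖`). -/
theorem norm_sq_le_cellIntegral {G G₁ : ℝ → ℂ} (hG : ∀ s, HasDerivAt G (G₁ s) s) (hG₁c : Continuous G₁) {k : ℤ} {t : ℝ}
    (ht : t ∈ Icc ((k : ℝ) - 1 / 2) ((k : ℝ) + 1 / 2)) :
    ‖G t‖ ^ 2 ≤ ∫ s in Icc ((k : ℝ) - 1 / 2) ((k : ℝ) + 1 / 2), (‖G s‖ ^ 2 + 2 * ‖G s‖ * ‖G₁ s‖) := by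
  have hGc : Continuous G := continuous_iff_continuousAt.2 fun x ↦ (hG x).continuousAt
  have hF : ∀ s, HasDerivAt (fun s ↦ ‖G s‖ ^ 2) (2 * inner ℝ (G s) (G₁ s)) s := fun s ↦ (hG s).norm_sq
  have hF'c : Continuous fun s ↦ 2 * inner ℝ (G s) (G₁ s) := continuous_const.mul (hGc.inner hG₁c)
  have hcell := le_cellIntegral_add_of_hasDerivAt hF hF'c ht
  have hFi : IntegrableOn (fun s ↦ ‖G s‖ ^ 2) (Icc ((k : ℝ) - 1 / 2) ((k : ℝ) + 1 / 2)) :=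
    (hGc.norm.pow 2).continuousOn.integrableOn_Icc
  have hPi : IntegrableOn (fun s ↦ 2 * ‖G s‖ * ‖G₁ s‖) (Icc ((k : ℝ) - 1 / 2) ((k : ℝ) + 1 / 2)) :=
    ((continuous_const.mul hGc.norm).mul hG₁c.norm).continuousOn.integrableOn_Icc
  have hAi : IntegrableOn (fun s ↦ |2 * inner ℝ (G s) (G₁ s)|) (Icc ((k : ℝ) - 1 / 2) ((k : ℝ) + 1 / 2)) :=
    hF'c.abs.continuousOn.integrableOn_Icc
  have hle : ∫ s in Icc ((k : ℝ) - 1 / 2) ((k : ℝ) + 1 / 2), |2 * inner ℝ (G s) (G₁ s)|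
      ≤ ∫ s in Icc ((k : ℝ) - 1 / 2) ((k : ℝ) + 1 / 2), 2 * ‖G s‖ * ‖G₁ s‖ := by
    refine setIntegral_mono_on hAi hPi measurableSet_Icc fun s _ ↦ ?_
    rw [abs_mul, abs_two, mul_assoc]
    exact mul_le_mul_of_nonneg_left (abs_real_inner_le_norm _ _) (by norm_num)
  rw [integral_add hFi hPi]
  exact hcell.trans (by linarith only [hle])

variable {g : ℝ → ℂ}


/-- **`‖ĝ(½+it)‖²` is dominated by its cell integrals**: for a Weil test `g`, `ĝ₁ = (ixg)^` and `t ∈ [k − ½, k + ½]`,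
`‖ĝ(½+it)‖² ≤ ∫_{[k−½,k+½]} (‖ĝ(½+is)‖² + 2‖ĝ(½+is)‖·‖ĝ₁(½+is)‖) ds`. -/
theorem norm_sq_weilMellin_le_cellIntegral (hg : IsWeilTest g) {k : ℤ} {t : ℝ}
    (ht : t ∈ Icc ((k : ℝ) - 1 / 2) ((k : ℝ) + 1 / 2)) :
    ‖weilMellin g (1 / 2 + t * I)‖ ^ 2
      ≤ ∫ s in Icc ((k : ℝ) - 1 / 2) ((k : ℝ) + 1 / 2),
          (‖weilMellin g (1 / 2 + s * I)‖ ^ 2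
            + 2 * ‖weilMellin g (1 / 2 + s * I)‖ * ‖weilMellin (fun x : ℝ ↦ I * x * g x) (1 / 2 + s * I)‖) := by
  obtain ⟨G, hG⟩ : ∃ G : ℝ → ℂ, G = fun s : ℝ ↦ weilMellin g (1 / 2 + s * I) := ⟨_, rfl⟩
  obtain ⟨G₁, hG₁⟩ : ∃ G₁ : ℝ → ℂ, G₁ = fun s : ℝ ↦ weilMellin (fun x : ℝ ↦ I * x * g x) (1 / 2 + s * I) := ⟨_, rfl⟩
  have hd : ∀ s, HasDerivAt G (G₁ s) s := by
    rw [hG, hG₁]; exact fun s ↦ hasDerivAt_weilMellin_vertical hg.1.continuous hg.2 s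
  have hc : Continuous G₁ := by
    rw [hG₁]; exact continuous_weilMellin_line hg.I_mul
  have h := norm_sq_le_cellIntegral hd hc ht
  rw [hG, hG₁] at h
  exact h

/-! ## §3 The zero-height measure against a cell majorant; the zero energy under RH -/

/-- **Integration against the zero-height measure under a cell majorant.**  With the local zero-count constant `C_w`
(`ZeroOrdinateSums.exists_sum_le_of_abs_im_sub_le`): if `F ≥ 0` is continuous, `F(Im ρ) ≤ ψ(round(Im ρ))` on the non-trivial zeros,
`ψ ≥ 0`, and `Σ_{k∈K} ψ(k) log(|k|+2) ≤ Ψ` for all finite `K`, then `∫ F dν ≤ C_w·Ψ` (`ν = WeilBochner.zetaZeroHeightMeasure`). -/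
theorem exists_integral_zetaZeroHeightMeasure_le :
    ∃ C : ℝ, 0 < C ∧ ∀ {F : ℝ → ℝ}, Continuous F → (∀ t, 0 ≤ F t) → ∀ {ψ : ℤ → ℝ}, (∀ k, 0 ≤ ψ k) →
      (∀ ρ ∈ ZetaZeros.riemannZetaNontrivialZeros, F ρ.im ≤ ψ (round ρ.im)) → ∀ {Ψ : ℝ},
      (∀ K : Finset ℤ, ∑ k ∈ K, ψ k * Real.log (|(k : ℝ)| + 2) ≤ Ψ) →
      ∫ t, F t ∂WeilBochner.zetaZeroHeightMeasure ≤ C * Ψ := by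
  obtain ⟨C, hC0, hC⟩ := ZeroOrdinateSums.exists_sum_le_of_abs_im_sub_le
  refine ⟨C, hC0, fun {F} hFc hF0 {ψ} hψ0 hmaj {Ψ} hΨ ↦ ?_⟩
  -- ordinate-majorant summation
  obtain ⟨hsum, hle⟩ := ZeroOrdinateSums.tsum_mul_le_of_ordinate_majorant hC0.le hC (g := fun ρ ↦ F ρ.im) hψ0
    (fun ρ _ ↦ hF0 _) hmaj hΨ
  -- `∫ F dν = Σ_ρ m(ρ) F(Im ρ)` via the `lintegral` against the sum of Dirac masses
  set m : ZetaZeros.riemannZetaNontrivialZeros → ℕ := fun ρ ↦ (riemannZetaZeroOrder (ρ : ℂ)).toNat with hm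
  have hmR : ∀ ρ : ZetaZeros.riemannZetaNontrivialZeros, ((m ρ : ℕ) : ℝ) = (riemannZetaZeroOrder (ρ : ℂ) : ℝ) :=
    fun ρ ↦ by
      have h1 : ((m ρ : ℕ) : ℤ) = riemannZetaZeroOrder (ρ : ℂ) :=
        Int.toNat_of_nonneg (by linarith [ZetaZeros.riemannZetaNontrivialZeros.one_le_order ρ.2])
      rw [← Int.cast_natCast, h1]
  have hterm0 : ∀ ρ : ZetaZeros.riemannZetaNontrivialZeros, 0 ≤ (m ρ : ℝ) * F (ρ : ℂ).im := fun ρ ↦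
    mul_nonneg (Nat.cast_nonneg _) (hF0 _)
  have hsumR : Summable fun ρ : ZetaZeros.riemannZetaNontrivialZeros ↦ (m ρ : ℝ) * F (ρ : ℂ).im :=
    hsum.congr fun ρ ↦ by rw [hmR]
  set S : ℝ := ∑' ρ : ZetaZeros.riemannZetaNontrivialZeros, (m ρ : ℝ) * F (ρ : ℂ).im with hS
  have hS0 : 0 ≤ S := tsum_nonneg hterm0
  have hSle : S ≤ C * Ψ := by
    have e : S = ∑' ρ : ZetaZeros.riemannZetaNontrivialZeros, (riemannZetaZeroOrder (ρ : ℂ) : ℝ) * F (ρ : ℂ).im :=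
      tsum_congr fun ρ ↦ by rw [hmR]
    rw [e]; exact hle
  have hlint : ∫⁻ t, ENNReal.ofReal (F t) ∂WeilBochner.zetaZeroHeightMeasure = ENNReal.ofReal S := by
    rw [WeilBochner.lintegral_zetaZeroHeightMeasure hFc.measurable.ennreal_ofReal, hS,
      ENNReal.ofReal_tsum_of_nonneg hterm0 hsumR]
    refine tsum_congr fun ρ ↦ ?_
    rw [ENNReal.ofReal_mul (Nat.cast_nonneg _), ENNReal.ofReal_natCast]
  have hI : ∫ t, F t ∂WeilBochner.zetaZeroHeightMeasure = S := by
    rw [integral_eq_lintegral_of_nonneg_ae (ae_of_all _ hF0) hFc.aestronglyMeasurable, hlint,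
      ENNReal.toReal_ofReal hS0]
  rw [hI]
  exact hSle

/-- ★ **ZERO ENERGY ≤ C_w × (cell sums against `log(|k|+2)`), under RH.**  There is a universal `C > 0` such that for every
Weil test `g`, under RH: if `Σ_{k∈K} ψ_g(k)·log(|k|+2) ≤ Ψ` for all finite `K ⊆ ℤ`, where
`ψ_g(k) = ∫_{[k−½,k+½]} (‖ĝ(½+is)‖² + 2‖ĝ(½+is)‖‖ĝ₁(½+is)‖) ds` (`ĝ₁ = (ixg)^`), then `Re Q(g) ≤ C·Ψ`
(Weil's form is the zero energy `∫‖ĝ(½+it)‖²dν` under RH, `WeilBochner.weilQuadratic_eq_integral_of_riemannHypothesis`). -/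
theorem weilQuadratic_re_le_of_cellBound_of_RH :
    ∃ C : ℝ, 0 < C ∧ ∀ {g : ℝ → ℂ}, IsWeilTest g → RiemannHypothesis → ∀ {Ψ : ℝ},
      (∀ K : Finset ℤ, ∑ k ∈ K, (∫ s in Icc ((k : ℝ) - 1 / 2) ((k : ℝ) + 1 / 2),
          (‖weilMellin g (1 / 2 + s * I)‖ ^ 2
            + 2 * ‖weilMellin g (1 / 2 + s * I)‖ * ‖weilMellin (fun x : ℝ ↦ I * x * g x) (1 / 2 + s * I)‖))
          * Real.log (|(k : ℝ)| + 2) ≤ Ψ) →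
      (weilQuadratic g).re ≤ C * Ψ := by
  obtain ⟨C, hC0, hC⟩ := exists_integral_zetaZeroHeightMeasure_le
  refine ⟨C, hC0, fun {g} hg hRH {Ψ} hΨ ↦ ?_⟩
  obtain ⟨F, hF⟩ : ∃ F : ℝ → ℝ, F = fun t : ℝ ↦ ‖weilMellin g (1 / 2 + t * I)‖ ^ 2 := ⟨_, rfl⟩
  obtain ⟨ψ, hψ⟩ : ∃ ψ : ℤ → ℝ, ψ = fun k : ℤ ↦ ∫ s in Icc ((k : ℝ) - 1 / 2) ((k : ℝ) + 1 / 2),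
      (‖weilMellin g (1 / 2 + s * I)‖ ^ 2
        + 2 * ‖weilMellin g (1 / 2 + s * I)‖ * ‖weilMellin (fun x : ℝ ↦ I * x * g x) (1 / 2 + s * I)‖) := ⟨_, rfl⟩
  have hψ0 : ∀ k, 0 ≤ ψ k := fun k ↦ by
    rw [hψ]; exact setIntegral_nonneg measurableSet_Icc fun s _ ↦ by positivity
  have hF0 : ∀ t, 0 ≤ F t := fun t ↦ by rw [hF]; positivity
  have hFc : Continuous F := by
    rw [hF]; exact (continuous_weilMellin_line hg).norm.pow 2
  have hmaj : ∀ ρ ∈ ZetaZeros.riemannZetaNontrivialZeros, F ρ.im ≤ ψ (round ρ.im) := by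
    intro ρ _
    have hcell : ρ.im ∈ Icc ((round ρ.im : ℝ) - 1 / 2) ((round ρ.im : ℝ) + 1 / 2) := by
      have h := abs_sub_round ρ.im
      rw [abs_le] at h
      exact ⟨by linarith [h.1], by linarith [h.2]⟩
    rw [hF, hψ]
    exact norm_sq_weilMellin_le_cellIntegral hg hcell
  have hΨ' : ∀ K : Finset ℤ, ∑ k ∈ K, ψ k * Real.log (|(k : ℝ)| + 2) ≤ Ψ := by rw [hψ]; exact hΨ
  have hre : (weilQuadratic g).re = ∫ t, F t ∂WeilBochner.zetaZeroHeightMeasure := by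
    rw [(WeilBochner.weilQuadratic_eq_integral_of_riemannHypothesis hRH hg).2, Complex.ofReal_re, hF]
  rw [hre]
  exact hC hFc hF0 hψ0 hmaj hΨ'

end FloorZeroEnergy

end Summit.RiemannHypothesis.RiemannHypothesis.Theorems.WeilFormatC
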